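import Mathlib
import Literature.NumberTheory.Transcendental.PadicLogPrincipalUnits
import Literature.NumberTheory.LocalFields.PadicExpLogHomomorphisms
import Literature.NumberTheory.EllipticCurves.PAdicOneVariableSupportOfColemanTraceTwo
import Literature.NumberTheory.GaloisRepresentations.LubinTateComparisonAddPoints
import Literature.NumberTheory.GaloisRepresentations.LubinTateColemanRelativeInterpolationTwo
import Literature.NumberTheory.GaloisRepresentations.LubinTateColemanRelativeAnomalyTwo
import Literature.NumberTheory.GaloisRepresentations.LubinTateComparisonReflectionTwo
import Literature.NumberTheory.EllipticCurves.PAdicOneVariableSeriesFamilyOfRelNormCoherentUnits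
import HarnessLib

/-!
# STUB IDEAS — `stub_heegnerIndexLowerAtTwo`, ideator k = 1, gen 41 (technique: weaken / strengthen)

**Node attacked: STUB-PLAN v7.5 ORDER NOW, road B′, R219-INST₂-CORE (α)** «the `∘ϑ`-line instance at `P := Q_b`»
(critic g42 itemisation (α)–(δ), `CRITIC-ROWS-g42.md` rows 119–121, B74) **+ the (β)-KEY** «`V = L_b + c` with the
constants keyed» — the two witness-specific pieces left of R219-INST₂ after J10.  Nothing on road A′ (R223-H is
PROVED twice, K57) and nothing at junction J (k3-g42) is touched; no INST₂ LEAF is re-derived (K58) — the leaves of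
record are COPIED VERBATIM with credit (Parts V1–V4) because crux workfiles are not importable (B74).

**BSD is NOT proved by any of this.**  This file closes, in the kernel, one M-sized witness-specific instance inside
one stub (`stub_heegnerIndexLowerAtTwo`) of one crux (`PrintCf2.SplitBadTwoLowerHalfOfFacts`); the stub, the crux,
`PrintCf2.closes` and BSD stay open.

## What is new (Part M, namespace `…InstCoreK1G41`, 0 sorry)
* §A `sub_one_mem_coeffIdeal_span_iff` — THE CURRENCY BRIDGE between the STRONGEST producer in the tree / k3-g39
  (`reflQuot_sub_one_mem : Q_β − 1 ∈ coeffIdeal (π')`, ideal currency in `𝒪_E⟦X⟧`) and the WEAKEST hypothesis of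
  the consumer of record J10 (`P(0) = 1 ∧ ∀ n, 2 ∣ [X^{n+1}]P`, divisibility currency in `𝒪_ℂ⟦X⟧`), with
  functoriality of `coeffIdeal` under `map`/`subst` and the re-gauge `(u·2) = (2)`.
* §B/§C the witness in `𝒪_ℂ⟦X⟧`: `Q̄_β := (reflQuot β).map (𝒪_E → 𝒪_ℂ)` (it is `j`-FREE), `2 ∣ Q̄_β(0) − 1`, hence
  the GAUGE UNIT `a_β := Q̄_β(0) ∈ 𝒪_ℂˣ` (principal ⟹ unit, by hand) and the NORMALISED quotient `P_β := a_β⁻¹·Q̄_β`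
  with `P_β(0) = 1`, `2 ∣ [X^{n+1}]P_β` — exactly J10's `(P, hP0, hP)`.
* §D ★★ `inst₂_core_alpha` — R219-INST₂-CORE (α) CLOSED: for every `β` and every `z₀ ∈ 𝔪_ℂ` the reading witness
  `(L∘y)∘ϑ̄` exists in `𝒪_ℂ⟦S⟧` and `Σ_m θ([S^m](L∘y∘ϑ̄))·θ(z₀)^m = ½·plog θ(P_β(ϑ̄ z₀))` — J10 at the point
  `ϑ̄(z₀)` ▸ k3-g40 `tsum_coeff_map_subst_mul_pow_eq` ▸ tree `evS_subst`; frame hypotheses only.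
* §E ★ (β)-KEY `half_plog_reflQuotN_eq`: `½·plog θ(P_β(ϑ̄ z₀)) = ½·plog θ(Q̄_β(ϑ̄ z₀)) + c_β`,
  `c_β := −½·plog θ(a_β)` INDEPENDENT of `z₀` (→ `read₂_of_refl_cut`'s `c`); ★ `map_subst_thetaBar_reflQuotC_eq_transport`:
  `θ̄(Q̄_β∘ϑ̄) = transport (reflQuot β)` (k3-g39's `V_β`-carrier, tree `map_subst_compSeriesC_map_eq`, the ONLY use
  of `j`/`hjC`); ★★ `inst₂_core_alpha_beta`: the two combined in the consumed shape.
* §F (β′) LOG-BRANCH remark: `g_β(w_a)` is a unit but not a principal unit of `𝒪_ℂ` in general (`k_E ⊋ 𝔽₂`), and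
  `plog` of record is the principal branch — the table `Lg` of the REFL presentation must be taken on `g_β/g_β(0)`;
  the reflection quotient is invariant under that gauge (`quot_mul_reflE_rescale`).

## Credits (verbatim parts; sha16 of the source workfiles in the crux directory)
* Part V1 = k3-g40 `STUB_IDEAS_…_3_g40.lean` §2–§3 (`2333f3139e2b61f4`); Part V2 = k2-g41 `STUB_IDEAS_…_2_g41.lean`
  §D–§E (`cd4b39d39d1ff210`); Part V3 = k3-g39 `STUB_IDEAS_…_3_g39.lean` §D/§E excerpt (`a08256b05cf54030`);
  Part V4 = critic `critic_g42_junction.lean` J10 (`0240c8426823ff9b`).  Literature: [cite: deShalit1987, Ch. I §3,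
  II §4.12–4.14]; [cite: Rubin1991, §7]; tree modules as imported.
-/

noncomputable section

set_option linter.dupNamespace false
set_option linter.unusedSectionVars false

open scoped PowerSeries.WithPiTopology

namespace Summit.BirchSwinnertonDyer.BirchSwinnertonDyer.Cruxes.SplitBadTwoLowerHalfOfFacts.ReadTwoCutK3G40

/-! ### PART V1 — VERBATIM from k3-g40 `STUB_IDEAS_stub_heegnerIndexLowerAtTwo_3_g40.lean` (sha16 `2333f3139e2b61f4`), §2 (ll. 126–226) and §3 (ll. 233–361): the consumers of record `tsum_coeff_map_subst_mul_pow_eq`, `lambda_value_refl_evS`, `read_value_eq_tsum_lamTerm` (credit: k3-g40; copied because workfiles are not importable — B74). -/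

section LambdaSplit

open Literature.NumberTheory.Transcendental

variable {𝕜 : Type*} [NontriviallyNormedField 𝕜] [NormedAlgebra ℚ_[2] 𝕜] [IsUltrametricDist 𝕜] [CompleteSpace 𝕜]

/-- `‖2‖ = ½` in a normed `ℚ₂`-algebra. -/
theorem norm_two : ‖(2 : 𝕜)‖ = 2⁻¹ := by
  have h := IwasawaLog.norm_natCast (F := 𝕜) 2 2
  have hp : ‖((2 : ℕ) : ℚ_[2])‖ = ((2 : ℕ) : ℝ)⁻¹ := Padic.norm_p
  simp only [Nat.cast_ofNat] at h hp
  rw [h, hp]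

theorem two_ne_zero' : (2 : 𝕜) ≠ 0 := by
  intro h
  have := norm_two (𝕜 := 𝕜)
  rw [h, norm_zero] at this
  norm_num at this

/-- The terms of `Λ₂` at `t`: `(−1)^d · 2^d/(d+1) · t^{d+1}` (`= logScalar 2 (d+1) · t^{d+1}` in k1-g37's notation). -/
def lamTerm (t : 𝕜) (d : ℕ) : 𝕜 := (-1) ^ d * (2 : 𝕜) ^ d / ((d : 𝕜) + 1) * t ^ (d + 1)

/-- Term bound on the CLOSED unit ball: `‖lamTerm t d‖ ≤ (d+1)·2^{−d}`. -/
theorem norm_lamTerm_le {t : 𝕜} (ht : ‖t‖ ≤ 1) (d : ℕ) :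
    ‖lamTerm t d‖ ≤ ((d : ℝ) + 1) * (2⁻¹ : ℝ) ^ d := by
  unfold lamTerm
  have hinv : ‖((d : 𝕜) + 1)⁻¹‖ ≤ (d : ℝ) + 1 := by
    have h := IwasawaLog.norm_inv_natCast_le (F := 𝕜) 2 (n := d + 1) (Nat.succ_ne_zero d)
    push_cast at h
    exact h
  rw [div_eq_mul_inv, norm_mul, norm_mul, norm_mul, norm_pow, norm_pow, norm_neg, norm_one, one_pow, one_mul,
    norm_two, norm_pow]
  calc (2⁻¹ : ℝ) ^ d * ‖((d : 𝕜) + 1)⁻¹‖ * ‖t‖ ^ (d + 1)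
      ≤ (2⁻¹ : ℝ) ^ d * ((d : ℝ) + 1) * 1 := by
        gcongr
        exact pow_le_one₀ (norm_nonneg _) ht
    _ = ((d : ℝ) + 1) * (2⁻¹ : ℝ) ^ d := by ring

/-- `Λ₂(t)` converges for `‖t‖ ≤ 1`. -/
theorem summable_lamTerm {t : 𝕜} (ht : ‖t‖ ≤ 1) : Summable (lamTerm t) := by
  have hr : ‖(2⁻¹ : ℝ)‖ < 1 := by rw [norm_inv, Real.norm_ofNat]; norm_num
  have hg : Summable fun d : ℕ => ((d : ℝ) + 1) * (2⁻¹ : ℝ) ^ d := by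
    have h1 : Summable fun d : ℕ => ((d : ℝ) ^ 1) * (2⁻¹ : ℝ) ^ d := summable_pow_mul_geometric_of_norm_lt_one 1 hr
    have h0 : Summable fun d : ℕ => (2⁻¹ : ℝ) ^ d := summable_geometric_of_norm_lt_one hr
    simpa [pow_one, add_mul] using h1.add h0
  exact Summable.of_norm_bounded hg (norm_lamTerm_le ht)

/-- `½ · plog(1 + 2t) = Σ' lamTerm t` (rescaling the defining Mercator series termwise). -/
theorem half_mul_plog_one_add_two_mul (t : 𝕜) :
    (2 : 𝕜)⁻¹ * PadicExp.plog (1 + 2 * t) = ∑' d, lamTerm t d := by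
  rw [Literature.NumberTheory.LocalFields.plog_one_add_eq_tsum, ← tsum_mul_left]
  refine tsum_congr fun d => ?_
  unfold lamTerm
  have h2 : (2 : 𝕜) ≠ 0 := two_ne_zero'
  rw [mul_pow, pow_succ (2 : 𝕜)]
  field_simp

/-- ★ `HasSum (lamTerm t) (½ · plog (1 + 2t))` on the closed unit ball. -/
theorem hasSum_lamTerm {t : 𝕜} (ht : ‖t‖ ≤ 1) :
    HasSum (lamTerm t) ((2 : 𝕜)⁻¹ * PadicExp.plog (1 + 2 * t)) := by
  rw [half_mul_plog_one_add_two_mul]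
  exact (summable_lamTerm ht).hasSum

/-- `plog (x² · y⁻¹) = 2·plog x − plog y` on principal units. -/
theorem plog_sq_mul_inv {x y : 𝕜} (hx : ‖1 - x‖ < 1) (hy : ‖1 - y‖ < 1) :
    PadicExp.plog (x ^ 2 * y⁻¹) = 2 * PadicExp.plog x - PadicExp.plog y := by
  rw [PadicExp.plog_mul (ℓ := 2) (IwasawaLog.norm_one_sub_pow_lt hx 2) (IwasawaLog.norm_one_sub_inv_lt hy),
    PadicExp.plog_pow (ℓ := 2) hx 2, PadicExp.plog_inv (ℓ := 2) hy]
  push_cast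
  ring

/-- `plog` of a quotient of principal units: `q·r = x ⟹ plog q = plog x − plog r` (REFL form: `Q_β · τ_E g = g`
evaluated at a point). -/
theorem plog_eq_sub_of_mul_eq {x q r : 𝕜} (hq : ‖1 - q‖ < 1) (hr : ‖1 - r‖ < 1) (h : q * r = x) :
    PadicExp.plog q = PadicExp.plog x - PadicExp.plog r := by
  rw [← h, PadicExp.plog_mul (ℓ := 2) hq hr]
  ring

/-- ★ **S4, REFL FORM (row 114's witness `½·logOf V_β`, `V_β ≡ 1 (mod 2)` by H6): `P = 1 + 2t` ⟹ `Λ₂(t) = ½·plog P`**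
— the defining Mercator series on the closed ball, nothing else. -/
theorem lambda_value_refl {P t : 𝕜} (ht : ‖t‖ ≤ 1) (hP : P = 1 + 2 * t) :
    ∑' d, lamTerm t d = (2 : 𝕜)⁻¹ * PadicExp.plog P := by
  rw [hP]
  exact (hasSum_lamTerm ht).tsum_eq

/-- ★★ **S4 — THE Λ-SPLIT AT A POINT.**  `x = g(w)`, `y = g^φ(f′w)` principal units, `t = y_g(w)` integral with the
EVALUATED congruence `x² = y(1 + 2t)` (a ring-hom image of k1-g37's `exists_unitRatio` datum), and `L` the value of the
convergent integral series `Λ₂ ∘ y_g` at `w` (§3 identifies it with `Σ' lamTerm t`): then `L = plog x − ½ plog y`. -/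
theorem lambda_value_split {x y t L : 𝕜} (hx : ‖1 - x‖ < 1) (hy : ‖1 - y‖ < 1) (ht : ‖t‖ ≤ 1)
    (hfac : x ^ 2 = y * (1 + 2 * t)) (hL : HasSum (lamTerm t) L) :
    L = PadicExp.plog x - (2 : 𝕜)⁻¹ * PadicExp.plog y := by
  have hy1 : ‖y‖ = 1 := IwasawaLog.norm_eq_one_of_norm_one_sub_lt hy
  have hy0 : y ≠ 0 := by
    intro h; rw [h, norm_zero] at hy1; exact zero_ne_one hy1
  have h2 : (2 : 𝕜) ≠ 0 := two_ne_zero'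
  have hquot : 1 + 2 * t = x ^ 2 * y⁻¹ := by
    rw [hfac]; field_simp
  rw [hL.unique (hasSum_lamTerm ht), hquot, plog_sq_mul_inv hx hy]
  field_simp

end LambdaSplit

section TreeEvaluation

open ValuativeRel IsLocalRing Field
open Literature.NumberTheory.GaloisRepresentations Literature.NumberTheory.GaloisRepresentations.IsNonarchimedeanLocalField
  Literature.NumberTheory.GaloisRepresentations.LubinTate Literature.NumberTheory.PAdicHodge
  Literature.NumberTheory.EllipticCurves

variable {F : Type} [Field F] [ValuativeRel F] [TopologicalSpace F] [IsNonarchimedeanLocalField F]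

attribute [local instance] ltNormUniformSpace ltNormIsUniformAddGroup rk1 nF nE fintypeResidueField

/-- ★ **SUBST–EVAL at a point of `𝔪_ℂ`, in `ℂ_F`**: the value of `R ∘ φ` at `z` is the value of `R` at `φ(z)`. -/
theorem tsum_coeff_subst_mul_pow_eq (R φ : PowerSeries (CBall F)) (hφ : PowerSeries.constantCoeff φ = 0)
    (z : (maxNilIdealC F).toIdeal) :
    ∑' m : ℕ, ((PowerSeries.coeff m (PowerSeries.subst φ R) : CBall F) : CompletedAlgClosure F) *
        ((z : CBall F) : CompletedAlgClosure F) ^ m =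
      ∑' d : ℕ, ((PowerSeries.coeff d R : CBall F) : CompletedAlgClosure F) *
        ((evS (maxNilIdealC F) z φ : CBall F) : CompletedAlgClosure F) ^ d := by
  have h := tsum_coeff_mul_pow_eq_evS R ⟨evS (maxNilIdealC F) z φ, evS_mem_of_constantCoeff_eq_zero _ z hφ⟩
  rw [tsum_coeff_mul_pow_eq_evS, evS_subst (maxNilIdealC F) z hφ R]
  exact h.symm

/-- ★ the same pushed along `θ : ℂ_F → ℂ_2` (the currency of `prints_family_def_two`). -/
theorem tsum_coeff_map_subst_mul_pow_eq (θ : CompletedAlgClosure F →+* ℂ_[2]) (hθc : Continuous θ)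
    (R φ : PowerSeries (CBall F)) (hφ : PowerSeries.constantCoeff φ = 0) (z : (maxNilIdealC F).toIdeal) :
    ∑' m : ℕ, PowerSeries.coeff m (PowerSeries.map (θ.comp (CBall F).subtype) (PowerSeries.subst φ R)) *
        (θ ((z : CBall F) : CompletedAlgClosure F)) ^ m =
      ∑' d : ℕ, PowerSeries.coeff d (PowerSeries.map (θ.comp (CBall F).subtype) R) *
        (θ ((evS (maxNilIdealC F) z φ : CBall F) : CompletedAlgClosure F)) ^ d := by
  have h := (hasSum_map_coeff_mul_pow θ hθc R
    ⟨evS (maxNilIdealC F) z φ, evS_mem_of_constantCoeff_eq_zero _ z hφ⟩).tsum_eq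
  rw [(hasSum_map_coeff_mul_pow θ hθc _ z).tsum_eq, evS_subst (maxNilIdealC F) z hφ R]
  exact h.symm

/-- Values of a principal series (`g(0) = 1`) at points of `𝔪_ℂ` are principal units of `ℂ_F`. -/
theorem norm_one_sub_evS_lt_one (g : PowerSeries (CBall F)) (hg : PowerSeries.constantCoeff g = 1)
    (z : (maxNilIdealC F).toIdeal) :
    ‖(1 : CompletedAlgClosure F) - ((evS (maxNilIdealC F) z g : CBall F) : CompletedAlgClosure F)‖ < 1 := by
  have h0 : PowerSeries.constantCoeff (g - 1) = 0 := by rw [map_sub, hg, map_one, sub_self]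
  have hmem : evS (maxNilIdealC F) z (g - 1) ∈ (maxNilIdealC F).toIdeal :=
    evS_mem_of_constantCoeff_eq_zero _ z h0
  have hlt : ‖((evS (maxNilIdealC F) z (g - 1) : CBall F) : CompletedAlgClosure F)‖ < 1 := hmem
  have hval : ((evS (maxNilIdealC F) z g : CBall F) : CompletedAlgClosure F) =
      1 + ((evS (maxNilIdealC F) z (g - 1) : CBall F) : CompletedAlgClosure F) := by
    rw [map_sub, map_one]; push_cast; ring
  rw [hval, sub_add_cancel_left, norm_neg]
  exact hlt

/-- The congruence datum EVALUATES: `g² = G·(1 + 2y)` in `𝒪_ℂ⟦X⟧` ⟹ `g(z)² = G(z)·(1 + 2·y(z))`. -/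
theorem evS_sq_eq_of_factorisation {g G y : PowerSeries (CBall F)}
    (h : g ^ 2 = G * (1 + PowerSeries.C (2 : CBall F) * y)) (z : (maxNilIdealC F).toIdeal) :
    (evS (maxNilIdealC F) z g) ^ 2 = evS (maxNilIdealC F) z G * (1 + 2 * evS (maxNilIdealC F) z y) := by
  have := congrArg (evS (maxNilIdealC F) z) h
  simpa [map_pow, map_mul, map_add, map_one, evS_C] using this

/-- ★ **S4 ASSEMBLED IN THE TREE'S CURRENCY** (composite of §2 and §3): for principal `g, G ∈ 𝒪_ℂ⟦X⟧`, integral `y`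
with `g² = G(1+2y)`, points `w` of `𝔪_ℂ`, and `θ : ℂ_F → ℂ_2` continuous, of norm `≤ 1` on `𝒪_ℂ` and mapping `𝔪_ℂ`
into the open unit ball (all three hold for the `θ` of record, `norm_equivPadicComplex_lt_one_iff`):
the value `Σ' lamTerm (θ y(w))` IS `plog θ(g(w)) − ½ plog θ(G(w))`. -/
theorem lambda_value_split_evS (θ : CompletedAlgClosure F →+* ℂ_[2])
    (hθ1 : ∀ z : CBall F, ‖θ (z : CompletedAlgClosure F)‖ ≤ 1)
    (hθlt : ∀ x : CompletedAlgClosure F, ‖x‖ < 1 → ‖θ x‖ < 1)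
    {g G y : PowerSeries (CBall F)} (hg : PowerSeries.constantCoeff g = 1) (hG : PowerSeries.constantCoeff G = 1)
    (h : g ^ 2 = G * (1 + PowerSeries.C (2 : CBall F) * y)) (w : (maxNilIdealC F).toIdeal) :
    ∑' d, lamTerm (θ ((evS (maxNilIdealC F) w y : CBall F) : CompletedAlgClosure F)) d =
      Literature.NumberTheory.Transcendental.PadicExp.plog
          (θ ((evS (maxNilIdealC F) w g : CBall F) : CompletedAlgClosure F)) -
        (2 : ℂ_[2])⁻¹ * Literature.NumberTheory.Transcendental.PadicExp.plog
          (θ ((evS (maxNilIdealC F) w G : CBall F) : CompletedAlgClosure F)) := by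
  have hx : ‖1 - θ ((evS (maxNilIdealC F) w g : CBall F) : CompletedAlgClosure F)‖ < 1 := by
    rw [← map_one θ, ← map_sub]; exact hθlt _ (norm_one_sub_evS_lt_one g hg w)
  have hy : ‖1 - θ ((evS (maxNilIdealC F) w G : CBall F) : CompletedAlgClosure F)‖ < 1 := by
    rw [← map_one θ, ← map_sub]; exact hθlt _ (norm_one_sub_evS_lt_one G hG w)
  have ht : ‖θ ((evS (maxNilIdealC F) w y : CBall F) : CompletedAlgClosure F)‖ ≤ 1 := hθ1 _
  have hfac := congrArg (fun s : CBall F => θ (s : CompletedAlgClosure F)) (evS_sq_eq_of_factorisation h w)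
  simp only [Subring.coe_mul, SubmonoidClass.coe_pow, Subring.coe_add, Subring.coe_one, map_mul, map_pow,
    map_add, map_one] at hfac
  have h2 : θ (((2 : CBall F) : CBall F) : CompletedAlgClosure F) = 2 := by
    rw [show (((2 : CBall F) : CBall F) : CompletedAlgClosure F) = 2 by norm_cast, map_ofNat]
  rw [h2] at hfac
  exact lambda_value_split hx hy ht hfac (summable_lamTerm ht).hasSum

/-- ★ **S4 (REFL presentation of record) IN THE TREE'S CURRENCY**: for `P = 1 + 2y ∈ 𝒪_ℂ⟦X⟧` (`P =` the reflection
quotient `Q_β = g_β/τ_E g_β` normalised to `Q(0) = 1`; `Q_β ≡ 1 (mod π')` is k3-g39's PROVED `reflQuot_sub_one_mem` /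
`transportedCongruence_holds`) and `w ∈ 𝔪_ℂ`: `Σ' lamTerm (θ y(w)) = ½·plog θ(P(w))`.  With `tsum_coeff_map_subst_mul_pow_eq`
this is R221 «EVAL₂» for the witness `½·logOf P = Λ₂(y)` (`logOf_one_add_two_smul`, §5): NO `logOf`-evaluation API. -/
theorem lambda_value_refl_evS (θ : CompletedAlgClosure F →+* ℂ_[2])
    (hθ1 : ∀ z : CBall F, ‖θ (z : CompletedAlgClosure F)‖ ≤ 1)
    {P y : PowerSeries (CBall F)} (hP : P = 1 + PowerSeries.C (2 : CBall F) * y) (w : (maxNilIdealC F).toIdeal) :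
    ∑' d, lamTerm (θ ((evS (maxNilIdealC F) w y : CBall F) : CompletedAlgClosure F)) d =
      (2 : ℂ_[2])⁻¹ * Literature.NumberTheory.Transcendental.PadicExp.plog
          (θ ((evS (maxNilIdealC F) w P : CBall F) : CompletedAlgClosure F)) := by
  have ht : ‖θ ((evS (maxNilIdealC F) w y : CBall F) : CompletedAlgClosure F)‖ ≤ 1 := hθ1 _
  have hev : evS (maxNilIdealC F) w P = 1 + 2 * evS (maxNilIdealC F) w y := by
    have := congrArg (evS (maxNilIdealC F) w) hP
    simpa [map_mul, map_add, map_one, evS_C] using this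
  have hfac := congrArg (fun s : CBall F => θ (s : CompletedAlgClosure F)) hev
  simp only [Subring.coe_mul, Subring.coe_add, Subring.coe_one, map_mul, map_add, map_one] at hfac
  have h2 : θ (((2 : CBall F) : CBall F) : CompletedAlgClosure F) = 2 := by
    rw [show (((2 : CBall F) : CBall F) : CompletedAlgClosure F) = 2 by norm_cast, map_ofNat]
  rw [h2] at hfac
  exact lambda_value_refl ht hfac

/-- ★★ **R221 «EVAL₂» — THE VALUE OF THE READING WITNESS, CLOSED IN KERNEL.**  For any `L ∈ 𝒪_ℂ⟦X⟧` whose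
`θ`-coefficients are the `Λ₂` scalars (`θ[X⁰]L = 0`, `θ[X^{d+1}]L = (−1)^d 2^d/(d+1)`; existence: `coeff_Lam2_succ` + the
integrality `‖2^d/(d+1)‖₂ ≤ 1` of `norm_lamTerm_le`) and any `y ∈ 𝒪_ℂ⟦X⟧` with `y(0) = 0`, the `θ`-value at `z ∈ 𝔪_ℂ` of
the composite `L∘y` (the series the reading actually evaluates, after `∘ϑ` which is one more `tsum_coeff_map_subst_mul_pow_eq`)
is `Σ' lamTerm (θ y(z))` — hence `½·plog θ P(z)` (REFL, `lambda_value_refl_evS`) or `plog θ g(z) − ½·plog θ G(z)` (FROB,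
`lambda_value_split_evS`).  Ingredients: tree `evS_subst`, `hasSum_map_coeff_mul_pow`; one reindexing.  No `logOf`-evaluation
theorem, no radius-of-convergence bookkeeping. -/
theorem read_value_eq_tsum_lamTerm (θ : CompletedAlgClosure F →+* ℂ_[2]) (hθc : Continuous θ)
    (L y : PowerSeries (CBall F)) (hy : PowerSeries.constantCoeff y = 0)
    (hL0 : θ ((PowerSeries.coeff 0 L : CBall F) : CompletedAlgClosure F) = 0)
    (hL : ∀ d : ℕ, θ ((PowerSeries.coeff (d + 1) L : CBall F) : CompletedAlgClosure F) =
      (-1) ^ d * (2 : ℂ_[2]) ^ d / ((d : ℂ_[2]) + 1))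
    (z : (maxNilIdealC F).toIdeal) :
    ∑' m : ℕ, PowerSeries.coeff m (PowerSeries.map (θ.comp (CBall F).subtype) (PowerSeries.subst y L)) *
        (θ ((z : CBall F) : CompletedAlgClosure F)) ^ m =
      ∑' d : ℕ, lamTerm (θ ((evS (maxNilIdealC F) z y : CBall F) : CompletedAlgClosure F)) d := by
  rw [tsum_coeff_map_subst_mul_pow_eq θ hθc L y hy z]
  have hs := (hasSum_map_coeff_mul_pow θ hθc L
    ⟨evS (maxNilIdealC F) z y, evS_mem_of_constantCoeff_eq_zero _ z hy⟩).summable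
  rw [hs.tsum_eq_zero_add]
  simp only [PowerSeries.coeff_map, RingHom.coe_comp, Function.comp_apply, Subring.coe_subtype]
  rw [hL0, zero_mul, zero_add]
  refine tsum_congr fun d => ?_
  rw [hL d, lamTerm]

end TreeEvaluation

end Summit.BirchSwinnertonDyer.BirchSwinnertonDyer.Cruxes.SplitBadTwoLowerHalfOfFacts.ReadTwoCutK3G40
namespace Summit.BirchSwinnertonDyer.BirchSwinnertonDyer.Cruxes.SplitBadTwoLowerHalfOfFacts.DisjointShiftK2G41

/-! ### PART V2 — VERBATIM from k2-g41 `STUB_IDEAS_stub_heegnerIndexLowerAtTwo_2_g41.lean` (sha16 `cd4b39d39d1ff210`), §D `LamTwoLift` (ll. 402–494) and §E `HalfLift` (ll. 499–514): the INST₂ leaves H3 / H1 of record (credit: k2-g41). -/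

section LamTwoLift

/-- Odd naturals are units in norm: `‖m‖ = 1` for `m` odd, in any ultrametric normed field with `‖2‖ < 1`. -/
theorem norm_natCast_eq_one_of_odd {L : Type*} [NormedField L] [IsUltrametricDist L] (h2 : ‖(2 : L)‖ < 1)
    {m : ℕ} (hm : Odd m) : ‖(m : L)‖ = 1 := by
  obtain ⟨k, rfl⟩ := hm
  have hk : ‖(2 * k : L)‖ < 1 := by
    rw [norm_mul]
    calc ‖(2 : L)‖ * ‖(k : L)‖ ≤ ‖(2 : L)‖ * 1 := by
          gcongr
          exact IsUltrametricDist.norm_natCast_le_one L k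
      _ < 1 := by rw [mul_one]; exact h2
  have hne : ‖(2 * k : L)‖ ≠ ‖(1 : L)‖ := by rw [norm_one]; exact hk.ne
  rw [Nat.cast_add, Nat.cast_mul, Nat.cast_two, Nat.cast_one,
    IsUltrametricDist.norm_add_eq_max_of_norm_ne_norm hne, norm_one, max_eq_right hk.le]

/-- ★ `‖2^d/(d+1)‖ ≤ 1` (`d+1 = 2^v·m`, `m` odd, `2^v ≤ d+1 ≤ 2^d`). -/
theorem norm_two_pow_div_le_one {L : Type*} [NormedField L] [IsUltrametricDist L] (h2 : ‖(2 : L)‖ < 1)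
    (d : ℕ) : ‖(2 : L) ^ d / ((d : L) + 1)‖ ≤ 1 := by
  obtain ⟨v, m, hm, hvm⟩ := Nat.exists_eq_two_pow_mul_odd (Nat.succ_ne_zero d)
  have hd1 : ((d : L) + 1) = (2 : L) ^ v * (m : L) := by
    have h := congrArg (Nat.cast : ℕ → L) hvm
    push_cast at h
    exact h
  have hv : v ≤ d := by
    have h1 : 2 ^ v ≤ d + 1 := by
      calc 2 ^ v ≤ 2 ^ v * m := Nat.le_mul_of_pos_right _ hm.pos
        _ = d + 1 := hvm.symm
    exact (Nat.pow_le_pow_iff_right (by norm_num)).mp (h1.trans Nat.lt_two_pow_self)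
  rw [norm_div, hd1, norm_mul, norm_natCast_eq_one_of_odd h2 hm, mul_one, norm_pow, norm_pow]
  exact div_le_one_of_le₀ (pow_le_pow_of_le_one (norm_nonneg _) h2.le hv) (by positivity)

open Literature.NumberTheory.GaloisRepresentations Literature.NumberTheory.GaloisRepresentations.IsNonarchimedeanLocalField
  Literature.NumberTheory.GaloisRepresentations.LubinTate Literature.NumberTheory.PAdicHodge

variable {F : Type} [Field F] [ValuativeRel F] [TopologicalSpace F] [IsNonarchimedeanLocalField F]

/-- The `Λ₂`-coefficient `(−1)^d 2^d/(d+1)` as an element of `𝒪_{ℂ_F}`. -/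
def lamCoeff (h2 : ‖(2 : CompletedAlgClosure F)‖ < 1) (d : ℕ) : CBall F :=
  ⟨(-1) ^ d * (2 : CompletedAlgClosure F) ^ d / ((d : CompletedAlgClosure F) + 1),
    (mem_unitBall_iff _).mpr (by
      rw [mul_div_assoc, norm_mul, norm_pow, norm_neg, norm_one, one_pow, one_mul]
      exact norm_two_pow_div_le_one h2 d)⟩

/-- The integral lift `L = Σ_{d≥0} (−1)^d 2^d/(d+1) · X^{d+1} ∈ 𝒪_{ℂ_F}⟦X⟧` of `Λ₂ = ½ log(1 + 2X)`. -/
def Lam2C (h2 : ‖(2 : CompletedAlgClosure F)‖ < 1) : PowerSeries (CBall F) :=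
  PowerSeries.mk fun n => if n = 0 then 0 else lamCoeff h2 (n - 1)

theorem coeff_zero_Lam2C (h2 : ‖(2 : CompletedAlgClosure F)‖ < 1) : PowerSeries.coeff 0 (Lam2C h2) = 0 := by
  rw [Lam2C, PowerSeries.coeff_mk, if_pos rfl]

theorem coeff_succ_Lam2C (h2 : ‖(2 : CompletedAlgClosure F)‖ < 1) (d : ℕ) :
    ((PowerSeries.coeff (d + 1) (Lam2C h2) : CBall F) : CompletedAlgClosure F) =
      (-1) ^ d * (2 : CompletedAlgClosure F) ^ d / ((d : CompletedAlgClosure F) + 1) := by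
  rw [Lam2C, PowerSeries.coeff_mk, if_neg (Nat.succ_ne_zero d), Nat.add_sub_cancel]
  rfl

/-- ★ **H3 «Λ₂-LIFT» (k3-g40 P3) PROVED**: in residue characteristic `2` (`‖2‖_{ℂ_F} < 1`, tree `norm_two_lt_one_C h2`)
there is `L ∈ 𝒪_{ℂ_F}⟦X⟧` with `L(0) = 0` and `[X^{d+1}]L = (−1)^d 2^d/(d+1)`. -/
theorem exists_Lam2_lift (h2 : ‖(2 : CompletedAlgClosure F)‖ < 1) :
    ∃ L : PowerSeries (CBall F), ((PowerSeries.coeff 0 L : CBall F) : CompletedAlgClosure F) = 0 ∧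
      ∀ d : ℕ, ((PowerSeries.coeff (d + 1) L : CBall F) : CompletedAlgClosure F) =
        (-1) ^ d * (2 : CompletedAlgClosure F) ^ d / ((d : CompletedAlgClosure F) + 1) :=
  ⟨Lam2C h2, by rw [coeff_zero_Lam2C]; rfl, coeff_succ_Lam2C h2⟩

/-- ★ The same in the EXACT hypothesis shape of k3-g40's `read_value_eq_tsum_lamTerm` (`hL0`, `hL`), for any ring
map `θ : ℂ_F → M` into a field (there `M = ℂ_[2]`). -/
theorem exists_Lam2_lift_map (h2 : ‖(2 : CompletedAlgClosure F)‖ < 1) {M : Type*} [Field M]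
    (θ : CompletedAlgClosure F →+* M) :
    ∃ L : PowerSeries (CBall F), θ ((PowerSeries.coeff 0 L : CBall F) : CompletedAlgClosure F) = 0 ∧
      ∀ d : ℕ, θ ((PowerSeries.coeff (d + 1) L : CBall F) : CompletedAlgClosure F) =
        (-1) ^ d * (2 : M) ^ d / ((d : M) + 1) := by
  refine ⟨Lam2C h2, ?_, fun d => ?_⟩
  · rw [coeff_zero_Lam2C]; exact map_zero θ
  · rw [coeff_succ_Lam2C, map_div₀, map_mul, map_pow, map_pow, map_neg, map_one, map_add, map_natCast, map_one,
      map_ofNat]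

/-- ★ Coefficientwise form matching k3-g40's `coeff_Lam2` (`Lam2 A := mk fun n ↦ if n = 0 then 0 else
algebraMap ℚ A ((−1)^{n+1} 2^{n−1}/n)`): under any ring map `θ` into a characteristic-0 field `M`,
`θ(L) = Lam2 M` coefficient by coefficient — i.e. `(Lam2C).map (θ ∘ subtype) = Lam2 M`. -/
theorem map_coeff_Lam2C (h2 : ‖(2 : CompletedAlgClosure F)‖ < 1) {M : Type*} [Field M] [CharZero M]
    (θ : CompletedAlgClosure F →+* M) (n : ℕ) :
    θ ((PowerSeries.coeff n (Lam2C h2) : CBall F) : CompletedAlgClosure F) =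
      if n = 0 then 0 else algebraMap ℚ M ((-1 : ℚ) ^ (n + 1) * 2 ^ (n - 1) / n) := by
  cases n with
  | zero => rw [if_pos rfl, coeff_zero_Lam2C]; exact map_zero θ
  | succ d =>
    rw [if_neg (Nat.succ_ne_zero d), coeff_succ_Lam2C, map_div₀, map_mul, map_pow, map_pow, map_neg, map_one,
      map_add, map_natCast, map_one, map_ofNat, Nat.add_sub_cancel, eq_ratCast]
    push_cast
    ring

end LamTwoLift

section HalfLift

theorem exists_eq_one_add_C_mul {A : Type*} [CommRing A] (a : A) (P : PowerSeries A)
    (hP0 : PowerSeries.constantCoeff P = 1) (hP : ∀ n : ℕ, a ∣ PowerSeries.coeff (n + 1) P) :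
    ∃ y : PowerSeries A, PowerSeries.constantCoeff y = 0 ∧ P = 1 + PowerSeries.C a * y := by
  classical
  choose c hc using hP
  refine ⟨PowerSeries.mk fun n => if n = 0 then 0 else c (n - 1), ?_, ?_⟩
  · rw [← PowerSeries.coeff_zero_eq_constantCoeff_apply, PowerSeries.coeff_mk, if_pos rfl]
  · ext n
    rw [map_add, PowerSeries.coeff_one, PowerSeries.coeff_C_mul, PowerSeries.coeff_mk]
    cases n with
    | zero => rw [if_pos rfl, if_pos rfl, mul_zero, add_zero, PowerSeries.coeff_zero_eq_constantCoeff_apply, hP0]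
    | succ k => rw [if_neg (Nat.succ_ne_zero k), if_neg (Nat.succ_ne_zero k), zero_add, Nat.add_sub_cancel, hc k]

end HalfLift

end Summit.BirchSwinnertonDyer.BirchSwinnertonDyer.Cruxes.SplitBadTwoLowerHalfOfFacts.DisjointShiftK2G41
namespace Summit.BirchSwinnertonDyer.BirchSwinnertonDyer.Cruxes.SplitBadTwoLowerHalfOfFacts.ReflectionPrimitiveK3G39

open Literature.NumberTheory.EllipticCurves

/-! ### PART V3 — VERBATIM EXCERPT from k3-g39 `STUB_IDEAS_stub_heegnerIndexLowerAtTwo_3_g39.lean` (sha16 `a08256b05cf54030`): §D ll. 334–347 (section header), 380–387 (`gUnit`, `reflQuot`), 406–421 (`reflQuot_sub_one_mem`, PROVED), §E ll. 445–470 (`readΘ`, `transport`) — decls token-identical, unrelated decls of those sections omitted (credit: k3-g39). -/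

section Reflection

open Literature.NumberTheory.GaloisRepresentations
open Literature.NumberTheory.GaloisRepresentations.IsNonarchimedeanLocalField
open Literature.NumberTheory.GaloisRepresentations.LubinTate ValuativeRel Field

variable {F : Type} [Field F] [ValuativeRel F] [TopologicalSpace F] [IsNonarchimedeanLocalField F]

attribute [local instance] ltNormUniformSpace ltNormIsUniformAddGroup rk1 nF nE fintypeResidueField

variable {π : 𝒪[F]} (hπ : (valuation F).IsUniformizer (π : F))
variable (E : IntermediateField F (AlgebraicClosure F)) [FiniteDimensional F E] [Normal F E] [IsGalois F E]
variable (hq : residueFieldCard F = 2) (hE : E ≤ maxUnramified F) {σ₀ : absoluteGaloisGroup F} (hσ₀ : IsAbsArithFrob σ₀)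

/-- The relative Coleman series `g_β` as a unit of `𝒪_E⟦X⟧`. [cite: deShalit1987, Ch. I §2.3] -/
def gUnit (β : RelNormCoherentUnits hπ E) : (PowerSeries (unitBall E))ˣ :=
  (isUnit_relColemanSeries hπ E hq hE hσ₀ β).unit

/-- ★ **THE REFLECTION QUOTIENT `Q_β := g_β / τ_E g_β = g_β(X) / g_β(−π−X)`** (a unit of `𝒪_E⟦X⟧`). -/
def reflQuot (β : RelNormCoherentUnits hπ E) : (PowerSeries (unitBall E))ˣ :=
  gUnit hπ E hq hE hσ₀ β * (reflEUnit hπ E (gUnit hπ E hq hE hσ₀ β))⁻¹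

/-- ★ **REFLECTION CONGRUENCE**: `Q_β ≡ 1 (mod π)` coefficientwise — from the tree's `τ_E G ≡ G (mod π)`
(`reflE_sub_self_mem_span`: `X [+] ω₁ − X = −2X − π ∈ (π)` as `2 = π t`). [cite: deShalit1987, Ch. I §3.12] -/
theorem reflQuot_sub_one_mem (β : RelNormCoherentUnits hπ E) :
    (reflQuot hπ E hq hE hσ₀ β : PowerSeries (unitBall E)) - 1 ∈
      coeffIdeal (Ideal.span {algebraMap 𝒪[F] (unitBall E) π}) := by
  have hτ := reflE_sub_self_mem_span hπ E hq (gUnit hπ E hq hE hσ₀ β : PowerSeries (unitBall E))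
  have hinv : (reflEUnit hπ E (gUnit hπ E hq hE hσ₀ β) : PowerSeries (unitBall E)) *
      ↑(reflEUnit hπ E (gUnit hπ E hq hE hσ₀ β))⁻¹ = 1 := Units.mul_inv _
  -- `Q − 1 = −(τg − g) · (τg)⁻¹`
  have e : (reflQuot hπ E hq hE hσ₀ β : PowerSeries (unitBall E)) - 1 =
      -(reflE hπ E (gUnit hπ E hq hE hσ₀ β : PowerSeries (unitBall E)) - ↑(gUnit hπ E hq hE hσ₀ β)) *
        ↑(reflEUnit hπ E (gUnit hπ E hq hE hσ₀ β))⁻¹ := by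
    rw [reflQuot, Units.val_mul, ← coe_reflEUnit]
    linear_combination hinv
  rw [e]
  exact Ideal.mul_mem_right _ _ (neg_mem hτ)

end Reflection

section Transport

open Literature.NumberTheory.GaloisRepresentations
open Literature.NumberTheory.GaloisRepresentations.IsNonarchimedeanLocalField
open Literature.NumberTheory.GaloisRepresentations.LubinTate ValuativeRel Field
open Literature.NumberTheory.PAdicHodge

variable {F : Type} [Field F] [ValuativeRel F] [TopologicalSpace F] [IsNonarchimedeanLocalField F]

attribute [local instance] ltNormUniformSpace ltNormIsUniformAddGroup rk1 nF nE fintypeResidueField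

variable (h2 : (valuation F).IsUniformizer (((2 : ℕ) : 𝒪[F]) : F)) (u : 𝒪[F]ˣ)
variable (E : IntermediateField F (AlgebraicClosure F)) [FiniteDimensional F E] [Normal F E] [IsGalois F E]
  (hq : residueFieldCard F = 2) (hE : E ≤ maxUnramified F) {σ₀ : absoluteGaloisGroup F} (hσ₀ : IsAbsArithFrob σ₀)
  (j : unitBall E →+* UnrCoeff F)
variable {ε : (maxUnramifiedCompletion F)ˣ}
  (hε : maxUnramifiedCompletion.galAut F σ₀ (ε : maxUnramifiedCompletion F) =
    algebraMap 𝒪[F] (maxUnramifiedCompletion F) (u : 𝒪[F]) * (ε : maxUnramifiedCompletion F))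
variable (θ : CompletedAlgClosure F →+* ℂ_[2])

/-- The reading map `Θ = θ ∘ (𝒪_{ℂ_F} ⊆ ℂ_F) ∘ (𝐃 → 𝒪_{ℂ_F}) : 𝐃 → ℂ₂` of the family of record. -/
def readΘ : UnrCoeff F →+* ℂ_[2] := θ.comp ((CBall F).subtype.comp (algebraMap (UnrCoeff F) (CBall F)))

/-- The TRANSPORT `L(G) := Θ(j(G) ∘ ϑ) : 𝒪_E⟦X⟧ → ℂ₂⟦S⟧` of the family of record (`H_β = L((δ_E g_β)~)`). -/
def transport (G : PowerSeries (unitBall E)) : PowerSeries ℂ_[2] :=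
  (PowerSeries.subst (compSeriesC h2 hσ₀ u hε) (G.map j)).map (readΘ θ)

end Transport

end Summit.BirchSwinnertonDyer.BirchSwinnertonDyer.Cruxes.SplitBadTwoLowerHalfOfFacts.ReflectionPrimitiveK3G39
namespace Summit.BirchSwinnertonDyer.BirchSwinnertonDyer.Cruxes.SplitBadTwoLowerHalfOfFacts.CriticG42

/-! ### PART V4 — VERBATIM EXCERPT from the critic's `critic_g42_junction.lean` (sha16 `0240c8426823ff9b`): section header ll. 2449–2457 and ★★ J10 `inst₂_leaves_assembled` ll. 2521–2538 — THE CONSUMER OF RECORD of R219-INST₂-CORE (α) (credit: critic g42). -/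

section LeavesJunction

open ValuativeRel IsLocalRing Field
open Literature.NumberTheory.GaloisRepresentations Literature.NumberTheory.GaloisRepresentations.IsNonarchimedeanLocalField
  Literature.NumberTheory.GaloisRepresentations.LubinTate Literature.NumberTheory.PAdicHodge

variable {F : Type} [Field F] [ValuativeRel F] [TopologicalSpace F] [IsNonarchimedeanLocalField F]

attribute [local instance] ltNormUniformSpace ltNormIsUniformAddGroup rk1 nF nE fintypeResidueField

/-- ★★ J10 «THE INST₂ LEAVES ASSEMBLED» (k2-g41 H1 ⊕ H3 ⊕ k3-g40 R221 ⊕ S4-REFL): for the reflection quotient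
`P ∈ 𝒪_ℂ⟦X⟧` with `P(0) = 1` and `2 ∣ [X^{n+1}]P`, the reading witness `L∘y` EXISTS in `𝒪_ℂ⟦X⟧` and its `θ`-value
at every `z ∈ 𝔪_ℂ` IS `½·plog θ P(z)` — hypothesis-free except the frame (`θ` continuous & integral, `‖2‖_ℂ < 1`).
What remains of R219-INST₂ after this is witness-specific only: the `∘ϑ` line, `V = L_b + c`, SEAM, ONE application. -/
theorem inst₂_leaves_assembled (θ : CompletedAlgClosure F →+* ℂ_[2]) (hθc : Continuous θ)
    (hθ1 : ∀ z : CBall F, ‖θ (z : CompletedAlgClosure F)‖ ≤ 1) (h2 : ‖(2 : CompletedAlgClosure F)‖ < 1)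
    (P : PowerSeries (CBall F)) (hP0 : PowerSeries.constantCoeff P = 1)
    (hP : ∀ n : ℕ, (2 : CBall F) ∣ PowerSeries.coeff (n + 1) P) (z : (maxNilIdealC F).toIdeal) :
    ∃ L y : PowerSeries (CBall F), PowerSeries.constantCoeff y = 0 ∧ P = 1 + PowerSeries.C (2 : CBall F) * y ∧
      θ ((PowerSeries.coeff 0 L : CBall F) : CompletedAlgClosure F) = 0 ∧
      ∑' m : ℕ, PowerSeries.coeff m (PowerSeries.map (θ.comp (CBall F).subtype) (PowerSeries.subst y L)) *
          (θ ((z : CBall F) : CompletedAlgClosure F)) ^ m =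
        (2 : ℂ_[2])⁻¹ * Literature.NumberTheory.Transcendental.PadicExp.plog
          (θ ((evS (maxNilIdealC F) z P : CBall F) : CompletedAlgClosure F)) := by
  obtain ⟨y, hy0, hPy⟩ := DisjointShiftK2G41.exists_eq_one_add_C_mul (2 : CBall F) P hP0 hP
  obtain ⟨L, hL0, hL⟩ := DisjointShiftK2G41.exists_Lam2_lift_map h2 θ
  exact ⟨L, y, hy0, hPy, hL0, (ReadTwoCutK3G40.read_value_eq_tsum_lamTerm θ hθc L y hy0 hL0 hL z).trans
    (ReadTwoCutK3G40.lambda_value_refl_evS θ hθ1 hPy z)⟩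

end LeavesJunction

end Summit.BirchSwinnertonDyer.BirchSwinnertonDyer.Cruxes.SplitBadTwoLowerHalfOfFacts.CriticG42
/-! ## PART M — NEW (k1-g41): R219-INST₂-CORE (α) «the `∘ϑ̄`-line instance at `P := Q_β`» CLOSED IN THE KERNEL,
plus the (β)-KEY (gauge constant) and the identification with k3-g39's transport `V_β`.

Technique «weaken / strengthen»: the WEAKEST hypothesis under which the consumer of record J10
(`CriticG42.inst₂_leaves_assembled`) fires is `P(0) = 1 ∧ ∀ n, 2 ∣ [X^{n+1}]P` in `𝒪_ℂ⟦X⟧` (divisibility currency);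
the STRONGEST thing the tree/k3-g39 produce about the witness is `Q_β − 1 ∈ coeffIdeal (π')` in `𝒪_E⟦X⟧`
(ideal currency, `π' = u·2`).  §A is the currency bridge (pure algebra), §B the unit/principal-unit facts in `𝒪_ℂ`,
§C the witness `Q̄_β`, its gauge unit `a_β = Q̄_β(0)` and the normalised `P_β := a_β⁻¹·Q̄_β` (J10's `P`), §D the
junction (α), §E the (β)-key and the identification `θ(Q̄_β∘ϑ̄) = transport (reflQuot β)`, §F the log-branch remark
and degenerate checks.  BSD is NOT proved by any of this. -/

namespace Summit.BirchSwinnertonDyer.BirchSwinnertonDyer.Cruxes.SplitBadTwoLowerHalfOfFacts.InstCoreK1G41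

/-! ### §A  The currency bridge `coeffIdeal (span {a}) ⟷ (a ∣ coefficients)` — pure commutative algebra. -/
section Algebra

open PowerSeries
open Literature.NumberTheory.GaloisRepresentations.LubinTate (coeffIdeal mem_coeffIdeal_iff)

variable {A B : Type*} [CommRing A] [CommRing B]

/-- Functoriality of `coeffIdeal` under `PowerSeries.map`. -/
theorem map_mem_coeffIdeal_map (f : A →+* B) {J : Ideal A} {G : PowerSeries A} (hG : G ∈ coeffIdeal J) :
    G.map f ∈ coeffIdeal (J.map f) :=
  mem_coeffIdeal_iff.mpr fun n => by
    rw [coeff_map]; exact Ideal.mem_map_of_mem f (mem_coeffIdeal_iff.mp hG n)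

/-- … in the `G − 1 ∈ coeffIdeal (span {a})` shape of k3-g39's `reflQuot_sub_one_mem`. -/
theorem map_sub_one_mem_coeffIdeal_span (f : A →+* B) {a : A} {G : PowerSeries A}
    (hG : G - 1 ∈ coeffIdeal (Ideal.span {a})) : G.map f - 1 ∈ coeffIdeal (Ideal.span {f a}) := by
  have h := map_mem_coeffIdeal_map f hG
  rw [map_sub, map_one, Ideal.map_span, Set.image_singleton] at h
  exact h

/-- `coeffIdeal J` is stable under substitution of a substitutable series (k3-g39's pattern, l. 601). -/
theorem subst_mem_coeffIdeal {φ : PowerSeries A} (hφ : PowerSeries.HasSubst φ) {J : Ideal A} {G : PowerSeries A}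
    (hG : G ∈ coeffIdeal J) : PowerSeries.subst φ G ∈ coeffIdeal J :=
  mem_coeffIdeal_iff.mpr fun n => by
    rw [PowerSeries.coeff_subst' hφ]
    exact finsum_induction (· ∈ J) J.zero_mem (fun _ _ hx hy => J.add_mem hx hy)
      fun d => by rw [smul_eq_mul]; exact J.mul_mem_right _ (mem_coeffIdeal_iff.mp hG d)

/-- … in the `G − 1` shape: the congruence `G ≡ 1` survives `∘φ` (the `∘ϑ̄` line never spends the congruence). -/
theorem subst_sub_one_mem_coeffIdeal {φ : PowerSeries A} (hφ : PowerSeries.HasSubst φ) {J : Ideal A}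
    {G : PowerSeries A} (hG : G - 1 ∈ coeffIdeal J) : PowerSeries.subst φ G - 1 ∈ coeffIdeal J := by
  have h := subst_mem_coeffIdeal hφ hG
  rw [← PowerSeries.coe_substAlgHom hφ] at h ⊢
  rw [map_sub, map_one] at h
  exact h

/-- RE-GAUGE: the congruence ideal sees the generator only up to units (`π' = u·2 ↦ 2`). -/
theorem span_singleton_unit_mul_eq {v : A} (hv : IsUnit v) (a : A) :
    Ideal.span ({v * a} : Set A) = Ideal.span {a} :=
  Ideal.span_singleton_mul_left_unit hv a

theorem coeff_zero_sub_one (P : PowerSeries A) :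
    PowerSeries.coeff 0 (P - 1) = PowerSeries.constantCoeff P - 1 := by
  rw [map_sub, PowerSeries.coeff_zero_eq_constantCoeff_apply, PowerSeries.coeff_zero_one]

theorem coeff_succ_sub_one (P : PowerSeries A) (n : ℕ) :
    PowerSeries.coeff (n + 1) (P - 1) = PowerSeries.coeff (n + 1) P := by
  rw [map_sub, PowerSeries.coeff_one, if_neg (Nat.succ_ne_zero n), sub_zero]

/-- ★ **THE CURRENCY BRIDGE**: ideal currency (k3-g39 / tree `coeffIdeal`) ⟺ divisibility currency (J10's
`hP0`/`hP`).  The WEAKEST form J10 needs is the right-hand side with `P(0) − 1 = 0`. -/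
theorem sub_one_mem_coeffIdeal_span_iff {a : A} {P : PowerSeries A} :
    P - 1 ∈ coeffIdeal (Ideal.span {a}) ↔
      (a ∣ PowerSeries.constantCoeff P - 1) ∧ ∀ n : ℕ, a ∣ PowerSeries.coeff (n + 1) P := by
  rw [mem_coeffIdeal_iff]
  constructor
  · intro h
    exact ⟨by rw [← coeff_zero_sub_one]; exact Ideal.mem_span_singleton.mp (h 0),
      fun n => by rw [← coeff_succ_sub_one P n]; exact Ideal.mem_span_singleton.mp (h (n + 1))⟩
  · rintro ⟨h0, hs⟩ n
    cases n with
    | zero => rw [coeff_zero_sub_one]; exact Ideal.mem_span_singleton.mpr h0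
    | succ n => rw [coeff_succ_sub_one]; exact Ideal.mem_span_singleton.mpr (hs n)

/-- NORMALISATION of the constant term by a unit (the gauge `a ↦ 1`). -/
theorem constantCoeff_C_inv_mul (a : Aˣ) {P : PowerSeries A} (hP : PowerSeries.constantCoeff P = a) :
    PowerSeries.constantCoeff (PowerSeries.C ((↑a⁻¹ : A)) * P) = 1 := by
  rw [map_mul, PowerSeries.constantCoeff_C, hP, Units.inv_mul]

/-- … which does not disturb the divisibility of the higher coefficients. -/
theorem dvd_coeff_succ_C_mul (c : A) {a : A} {P : PowerSeries A}
    (hP : ∀ n : ℕ, a ∣ PowerSeries.coeff (n + 1) P) (n : ℕ) :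
    a ∣ PowerSeries.coeff (n + 1) (PowerSeries.C c * P) := by
  rw [PowerSeries.coeff_C_mul]; exact Dvd.dvd.mul_left (hP n) c

/-- Degenerate check (B68-style): `P = 1` satisfies the weakest form trivially. -/
example (a : A) : (1 : PowerSeries A) - 1 ∈ coeffIdeal (Ideal.span {a}) := by
  rw [sub_self]; exact (coeffIdeal (Ideal.span {a})).zero_mem

/-- Sanity check of the bridge on `P = 1 + C a · X`: constant coefficient `1`, `a ∣` every higher coefficient. -/
example (a : A) : (1 + PowerSeries.C a * PowerSeries.X : PowerSeries A) - 1 ∈ coeffIdeal (Ideal.span {a}) := by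
  refine sub_one_mem_coeffIdeal_span_iff.mpr ⟨?_, fun n => ?_⟩
  · simp
  · rw [map_add, PowerSeries.coeff_one, if_neg (Nat.succ_ne_zero n), zero_add, PowerSeries.coeff_C_mul,
      PowerSeries.coeff_X]
    split_ifs
    · exact ⟨1, by ring⟩
    · exact ⟨0, by ring⟩

end Algebra

/-! ### §B  Units and principal units of `𝒪_ℂ = CBall F`, read through `θ : ℂ_F → ℂ₂` with `‖θ‖ ≤ 1` on `𝒪_ℂ` only. -/
section Ball

open ValuativeRel IsLocalRing Field
open Literature.NumberTheory.Transcendental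
open Literature.NumberTheory.GaloisRepresentations Literature.NumberTheory.GaloisRepresentations.IsNonarchimedeanLocalField
  Literature.NumberTheory.GaloisRepresentations.LubinTate Literature.NumberTheory.PAdicHodge

variable {F : Type} [Field F] [ValuativeRel F] [TopologicalSpace F] [IsNonarchimedeanLocalField F]

/-- `‖2‖ < 1` in `ℂ₂` (k3-g40's `norm_two`). -/
theorem norm_two_C2_lt_one : ‖(2 : ℂ_[2])‖ < 1 := by
  rw [ReadTwoCutK3G40.norm_two]; norm_num

/-- `2 ∣ a − 1` in `𝒪_ℂ` ⟹ `‖a − 1‖ < 1` in `ℂ_F`. -/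
theorem norm_sub_one_lt_one_of_two_dvd (h2 : ‖(2 : CompletedAlgClosure F)‖ < 1) {a : CBall F}
    (ha : (2 : CBall F) ∣ a - 1) : ‖((a : CBall F) : CompletedAlgClosure F) - 1‖ < 1 := by
  obtain ⟨t, ht⟩ := ha
  have e2 : ((2 : CBall F) : CompletedAlgClosure F) = 2 := map_ofNat (CBall F).subtype 2
  have e : (a : CompletedAlgClosure F) - 1 = 2 * (t : CompletedAlgClosure F) := by
    have := congrArg (fun s : CBall F => (s : CompletedAlgClosure F)) ht
    push_cast at this
    rw [e2] at this
    exact this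
  rw [e, norm_mul]
  calc ‖(2 : CompletedAlgClosure F)‖ * ‖(t : CompletedAlgClosure F)‖
      ≤ ‖(2 : CompletedAlgClosure F)‖ * 1 := by gcongr; exact (mem_unitBall_iff _).mp t.2
    _ < 1 := by rw [mul_one]; exact h2

/-- ★ principal elements of `𝒪_ℂ` are UNITS of `𝒪_ℂ` (the gauge constant `a_β = Q̄_β(0)` is invertible in `𝒪_ℂ`). -/
theorem isUnit_of_norm_sub_one_lt_one {a : CBall F}
    (ha : ‖((a : CBall F) : CompletedAlgClosure F) - 1‖ < 1) : IsUnit a := by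
  have ha1 : ‖(a : CompletedAlgClosure F)‖ = 1 :=
    IwasawaLog.norm_eq_one_of_norm_one_sub_lt (by rwa [norm_sub_rev] at ha)
  have ha0 : (a : CompletedAlgClosure F) ≠ 0 := fun h => by
    rw [h, norm_zero] at ha1; exact zero_ne_one ha1
  let b : CBall F := ⟨(a : CompletedAlgClosure F)⁻¹, (mem_unitBall_iff _).mpr (by rw [norm_inv, ha1, inv_one])⟩
  exact IsUnit.of_mul_eq_one b (Subtype.ext (mul_inv_cancel₀ ha0))

variable (θ : CompletedAlgClosure F →+* ℂ_[2]) (hθ1 : ∀ z : CBall F, ‖θ (z : CompletedAlgClosure F)‖ ≤ 1)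

include hθ1 in
/-- `2 ∣ a − 1` in `𝒪_ℂ` ⟹ `θ(a)` is a principal unit of `ℂ₂` — uses `hθ1` ONLY (no `hθlt`, cf. K-rule R221). -/
theorem norm_one_sub_map_lt_one_of_two_dvd {a : CBall F} (ha : (2 : CBall F) ∣ a - 1) :
    ‖1 - θ ((a : CBall F) : CompletedAlgClosure F)‖ < 1 := by
  obtain ⟨t, ht⟩ := ha
  have e2 : ((2 : CBall F) : CompletedAlgClosure F) = 2 := map_ofNat (CBall F).subtype 2
  have e : (a : CompletedAlgClosure F) = 1 + 2 * (t : CompletedAlgClosure F) := by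
    have := congrArg (fun s : CBall F => (s : CompletedAlgClosure F)) ht
    push_cast at this
    rw [e2] at this
    linear_combination this
  rw [e, map_add, map_one, map_mul, map_ofNat,
    show (1 : ℂ_[2]) - (1 + 2 * θ (t : CompletedAlgClosure F)) = -(2 * θ (t : CompletedAlgClosure F)) by ring,
    norm_neg, norm_mul]
  calc ‖(2 : ℂ_[2])‖ * ‖θ (t : CompletedAlgClosure F)‖ ≤ ‖(2 : ℂ_[2])‖ * 1 := by gcongr; exact hθ1 t
    _ < 1 := by rw [mul_one]; exact norm_two_C2_lt_one

/-- `2 ∣ P(w) − 1` in `𝒪_ℂ` for `P(0) = 1`, `2 ∣ [X^{n+1}]P`, `w ∈ 𝔪_ℂ` (via k2-g41's half-lift `P = 1 + 2y`). -/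
theorem two_dvd_evS_sub_one {P : PowerSeries (CBall F)} (hP0 : PowerSeries.constantCoeff P = 1)
    (hP : ∀ n : ℕ, (2 : CBall F) ∣ PowerSeries.coeff (n + 1) P) (w : (maxNilIdealC F).toIdeal) :
    (2 : CBall F) ∣ evS (maxNilIdealC F) w P - 1 := by
  obtain ⟨y, -, hPy⟩ := DisjointShiftK2G41.exists_eq_one_add_C_mul (2 : CBall F) P hP0 hP
  refine ⟨evS (maxNilIdealC F) w y, ?_⟩
  rw [hPy, map_add, map_one, map_mul, evS_C, add_sub_cancel_left]

end Ball

/-! ### §C  The witness: `ϑ̄`, `Q̄_β`, the gauge unit `a_β`, the normalised quotient `P_β`. -/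
section Witness

open ValuativeRel IsLocalRing Field
open Literature.NumberTheory.Transcendental
open Literature.NumberTheory.GaloisRepresentations Literature.NumberTheory.GaloisRepresentations.IsNonarchimedeanLocalField
  Literature.NumberTheory.GaloisRepresentations.LubinTate Literature.NumberTheory.PAdicHodge
  Literature.NumberTheory.EllipticCurves

variable {F : Type} [Field F] [ValuativeRel F] [TopologicalSpace F] [IsNonarchimedeanLocalField F]

attribute [local instance] ltNormUniformSpace ltNormIsUniformAddGroup rk1 nF nE fintypeResidueField

variable (hq : residueFieldCard F = 2) (h2 : (valuation F).IsUniformizer (((2 : ℕ) : 𝒪[F]) : F)) (u : 𝒪[F]ˣ)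
variable (E : IntermediateField F (AlgebraicClosure F)) [FiniteDimensional F E] [Normal F E] [IsGalois F E]
  (hE : E ≤ maxUnramified F) {σ₀ : absoluteGaloisGroup F} (hσ₀ : IsAbsArithFrob σ₀)
variable {ε : (maxUnramifiedCompletion F)ˣ}
  (hε : maxUnramifiedCompletion.galAut F σ₀ (ε : maxUnramifiedCompletion F) =
    algebraMap 𝒪[F] (maxUnramifiedCompletion F) (u : 𝒪[F]) * (ε : maxUnramifiedCompletion F))
variable (θ : CompletedAlgClosure F →+* ℂ_[2]) (hθc : Continuous θ)
  (hθ1 : ∀ z : CBall F, ‖θ (z : CompletedAlgClosure F)‖ ≤ 1)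

/-- `ϑ̄` — the comparison series of record read in `𝒪_ℂ⟦S⟧` (the tree's currency for points of the family:
`evalPt₁_compSeriesC_eq_mk_evS`).  It is `j`-FREE. -/
def thetaBar : PowerSeries (CBall F) := (compSeriesC h2 hσ₀ u hε).map (algebraMap (UnrCoeff F) (CBall F))

theorem constantCoeff_thetaBar : PowerSeries.constantCoeff (thetaBar h2 u hσ₀ hε) = 0 :=
  constantCoeff_map_compSeriesC hσ₀ u hε h2

theorem hasSubst_thetaBar : PowerSeries.HasSubst (thetaBar h2 u hσ₀ hε) :=
  PowerSeries.HasSubst.of_constantCoeff_zero' (constantCoeff_thetaBar h2 u hσ₀ hε)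

/-- `Q̄_β` — k3-g39's reflection quotient `Q_β = g_β / τ_E g_β` read in `𝒪_ℂ⟦X⟧` along `𝒪_E → 𝒪_ℂ`
(`unitBallToCBall E`).  It is `j`-FREE. -/
def reflQuotC (β : RelNormCoherentUnits (isUniformizer_unit_mul h2 u) E) : PowerSeries (CBall F) :=
  (ReflectionPrimitiveK3G39.reflQuot (isUniformizer_unit_mul h2 u) E hq hE hσ₀ β : PowerSeries (unitBall E)).map
    (unitBallToCBall E)

/-- The congruence generator `π' = u·2` of the frame, read in `𝒪_ℂ`, is `(unit)·2`. -/
theorem unitBallToCBall_algebraMap_generator :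
    unitBallToCBall E (algebraMap 𝒪[F] (unitBall E) ((u : 𝒪[F]) * ((2 : ℕ) : 𝒪[F]))) =
      unitBallToCBall E (algebraMap 𝒪[F] (unitBall E) (u : 𝒪[F])) * 2 := by
  rw [map_mul, map_mul, map_natCast, map_natCast, Nat.cast_ofNat]

theorem isUnit_unitBallToCBall_algebraMap_unit :
    IsUnit (unitBallToCBall E (algebraMap 𝒪[F] (unitBall E) (u : 𝒪[F]))) :=
  (u.isUnit.map _).map _

/-- ★ STRONGEST AVAILABLE, RE-GAUGED: `Q̄_β − 1 ∈ coeffIdeal (2)` in `𝒪_ℂ⟦X⟧` — k3-g39's `reflQuot_sub_one_mem`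
(ideal `(π')` of `𝒪_E`) pushed along `𝒪_E → 𝒪_ℂ` (`map_sub_one_mem_coeffIdeal_span`) and re-gauged `(u·2) = (2)`. -/
theorem reflQuotC_sub_one_mem (β : RelNormCoherentUnits (isUniformizer_unit_mul h2 u) E) :
    reflQuotC hq h2 u E hE hσ₀ β - 1 ∈ coeffIdeal (Ideal.span {(2 : CBall F)}) := by
  have h := map_sub_one_mem_coeffIdeal_span (unitBallToCBall E)
    (ReflectionPrimitiveK3G39.reflQuot_sub_one_mem (isUniformizer_unit_mul h2 u) E hq hE hσ₀ β)
  rw [unitBallToCBall_algebraMap_generator,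
    span_singleton_unit_mul_eq (isUnit_unitBallToCBall_algebraMap_unit u E)] at h
  exact h

/-- ★ … in J10's DIVISIBILITY currency, higher coefficients. -/
theorem two_dvd_coeff_succ_reflQuotC (β : RelNormCoherentUnits (isUniformizer_unit_mul h2 u) E) (n : ℕ) :
    (2 : CBall F) ∣ PowerSeries.coeff (n + 1) (reflQuotC hq h2 u E hE hσ₀ β) :=
  (sub_one_mem_coeffIdeal_span_iff.mp (reflQuotC_sub_one_mem hq h2 u E hE hσ₀ β)).2 n

/-- ★ … constant coefficient: `2 ∣ Q̄_β(0) − 1` (so `Q̄_β(0) = g_β(0)/g_β(ω₁')` is a principal unit, NOT `1`). -/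
theorem two_dvd_constantCoeff_reflQuotC_sub_one (β : RelNormCoherentUnits (isUniformizer_unit_mul h2 u) E) :
    (2 : CBall F) ∣ PowerSeries.constantCoeff (reflQuotC hq h2 u E hE hσ₀ β) - 1 :=
  (sub_one_mem_coeffIdeal_span_iff.mp (reflQuotC_sub_one_mem hq h2 u E hE hσ₀ β)).1

include h2 in
theorem isUnit_constantCoeff_reflQuotC (β : RelNormCoherentUnits (isUniformizer_unit_mul h2 u) E) :
    IsUnit (PowerSeries.constantCoeff (reflQuotC hq h2 u E hE hσ₀ β)) :=
  isUnit_of_norm_sub_one_lt_one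
    (norm_sub_one_lt_one_of_two_dvd (norm_two_lt_one_C h2) (two_dvd_constantCoeff_reflQuotC_sub_one hq h2 u E hE hσ₀ β))

/-- THE GAUGE UNIT `a_β := Q̄_β(0) ∈ 𝒪_ℂˣ`. -/
def gaugeUnit (β : RelNormCoherentUnits (isUniformizer_unit_mul h2 u) E) : (CBall F)ˣ :=
  (isUnit_constantCoeff_reflQuotC hq h2 u E hE hσ₀ β).unit

theorem coe_gaugeUnit (β : RelNormCoherentUnits (isUniformizer_unit_mul h2 u) E) :
    (gaugeUnit hq h2 u E hE hσ₀ β : CBall F) = PowerSeries.constantCoeff (reflQuotC hq h2 u E hE hσ₀ β) := rfl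

/-- ★ **THE NORMALISED REFLECTION QUOTIENT `P_β := a_β⁻¹ · Q̄_β ∈ 𝒪_ℂ⟦X⟧`** — J10's `P`. -/
def reflQuotN (β : RelNormCoherentUnits (isUniformizer_unit_mul h2 u) E) : PowerSeries (CBall F) :=
  PowerSeries.C ((↑(gaugeUnit hq h2 u E hE hσ₀ β)⁻¹ : CBall F)) * reflQuotC hq h2 u E hE hσ₀ β

/-- ★ J10's `hP0` for the witness. -/
theorem constantCoeff_reflQuotN (β : RelNormCoherentUnits (isUniformizer_unit_mul h2 u) E) :
    PowerSeries.constantCoeff (reflQuotN hq h2 u E hE hσ₀ β) = 1 :=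
  constantCoeff_C_inv_mul (gaugeUnit hq h2 u E hE hσ₀ β) (coe_gaugeUnit hq h2 u E hE hσ₀ β).symm

/-- ★ J10's `hP` for the witness. -/
theorem two_dvd_coeff_succ_reflQuotN (β : RelNormCoherentUnits (isUniformizer_unit_mul h2 u) E) (n : ℕ) :
    (2 : CBall F) ∣ PowerSeries.coeff (n + 1) (reflQuotN hq h2 u E hE hσ₀ β) :=
  dvd_coeff_succ_C_mul _ (two_dvd_coeff_succ_reflQuotC hq h2 u E hE hσ₀ β) n

/-! ### §D  ★★ R219-INST₂-CORE (α): the `∘ϑ̄`-line instance at `P := P_β`, junction with J10 closed in the kernel. -/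

include hθc hθ1 in
/-- ★★ **R219-INST₂-CORE (α) — THE `∘ϑ̄`-LINE INSTANCE AT THE WITNESS.**  For every relative norm-coherent unit
`β` and every point `z₀ ∈ 𝔪_ℂ` (the `σ a`-conjugate torsion point of `read₂_of_refl_cut`, read in `𝒪_ℂ`), the
reading witness `(L∘y)∘ϑ̄ ∈ 𝒪_ℂ⟦S⟧` of the NORMALISED reflection quotient `P_β` EXISTS and its `θ`-value at `z₀`,
computed as the reading computes it (`Σ_m θ([S^m]·)·θ(z₀)^m`), IS `½·plog θ(P_β(ϑ̄(z₀)))`.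
Assembly: producer §C (k3-g39's congruence ↦ J10's currency, normalised) ▸ J10 at the point `ϑ̄(z₀) ∈ 𝔪_ℂ`
▸ k3-g40's `tsum_coeff_map_subst_mul_pow_eq` (the `∘ϑ̄` line) ▸ tree `evS_subst`.  No hypothesis beyond the frame. -/
theorem inst₂_core_alpha (β : RelNormCoherentUnits (isUniformizer_unit_mul h2 u) E) (z₀ : (maxNilIdealC F).toIdeal) :
    ∃ L y : PowerSeries (CBall F), PowerSeries.constantCoeff y = 0 ∧
      reflQuotN hq h2 u E hE hσ₀ β = 1 + PowerSeries.C (2 : CBall F) * y ∧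
      θ ((PowerSeries.coeff 0 L : CBall F) : CompletedAlgClosure F) = 0 ∧
      ∑' m : ℕ, PowerSeries.coeff m (PowerSeries.map (θ.comp (CBall F).subtype)
          (PowerSeries.subst (thetaBar h2 u hσ₀ hε) (PowerSeries.subst y L))) *
          (θ ((z₀ : CBall F) : CompletedAlgClosure F)) ^ m =
        (2 : ℂ_[2])⁻¹ * PadicExp.plog
          (θ ((evS (maxNilIdealC F) z₀
            (PowerSeries.subst (thetaBar h2 u hσ₀ hε) (reflQuotN hq h2 u E hE hσ₀ β)) : CBall F) :
              CompletedAlgClosure F)) := by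
  obtain ⟨L, y, hy0, hPy, hL0, hval⟩ := CriticG42.inst₂_leaves_assembled θ hθc hθ1 (norm_two_lt_one_C h2)
    (reflQuotN hq h2 u E hE hσ₀ β) (constantCoeff_reflQuotN hq h2 u E hE hσ₀ β)
    (two_dvd_coeff_succ_reflQuotN hq h2 u E hE hσ₀ β)
    ⟨evS (maxNilIdealC F) z₀ (thetaBar h2 u hσ₀ hε),
      evS_mem_of_constantCoeff_eq_zero _ z₀ (constantCoeff_thetaBar h2 u hσ₀ hε)⟩
  refine ⟨L, y, hy0, hPy, hL0, ?_⟩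
  rw [ReadTwoCutK3G40.tsum_coeff_map_subst_mul_pow_eq θ hθc (PowerSeries.subst y L) (thetaBar h2 u hσ₀ hε)
      (constantCoeff_thetaBar h2 u hσ₀ hε) z₀,
    evS_subst (maxNilIdealC F) z₀ (constantCoeff_thetaBar h2 u hσ₀ hε)]
  exact hval

/-! ### §E  (β)-KEY: the gauge constant, and the identification with k3-g39's transport `V_β`. -/

/-- `P_β(ϑ̄(z₀)) = a_β⁻¹ · Q̄_β(ϑ̄(z₀))` in `𝒪_ℂ`. -/
theorem evS_subst_thetaBar_reflQuotN (β : RelNormCoherentUnits (isUniformizer_unit_mul h2 u) E)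
    (z₀ : (maxNilIdealC F).toIdeal) :
    evS (maxNilIdealC F) z₀ (PowerSeries.subst (thetaBar h2 u hσ₀ hε) (reflQuotN hq h2 u E hE hσ₀ β)) =
      (↑(gaugeUnit hq h2 u E hE hσ₀ β)⁻¹ : CBall F) *
        evS (maxNilIdealC F) z₀ (PowerSeries.subst (thetaBar h2 u hσ₀ hε) (reflQuotC hq h2 u E hE hσ₀ β)) := by
  rw [evS_subst (maxNilIdealC F) z₀ (constantCoeff_thetaBar h2 u hσ₀ hε),
    evS_subst (maxNilIdealC F) z₀ (constantCoeff_thetaBar h2 u hσ₀ hε), reflQuotN, map_mul, evS_C]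

/-- THE GAUGE CONSTANT of the reading: `c_β := −½·plog θ(a_β)` — INDEPENDENT of the evaluation point; it is what
`read₂_of_refl_cut`'s `c`-slot absorbs (critic (β), B67's «constant of integration invisible to χ₀ ≠ 1»). -/
def gaugeConst (β : RelNormCoherentUnits (isUniformizer_unit_mul h2 u) E) : ℂ_[2] :=
  -((2 : ℂ_[2])⁻¹ * PadicExp.plog (θ ((gaugeUnit hq h2 u E hE hσ₀ β : CBall F) : CompletedAlgClosure F)))

include hθ1 in
/-- `θ(a_β)` is a principal unit of `ℂ₂`. -/
theorem norm_one_sub_map_gaugeUnit_lt (β : RelNormCoherentUnits (isUniformizer_unit_mul h2 u) E) :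
    ‖1 - θ ((gaugeUnit hq h2 u E hE hσ₀ β : CBall F) : CompletedAlgClosure F)‖ < 1 :=
  norm_one_sub_map_lt_one_of_two_dvd θ hθ1 (two_dvd_constantCoeff_reflQuotC_sub_one hq h2 u E hE hσ₀ β)

include hθ1 in
/-- `θ(P_β(ϑ̄(z₀)))` is a principal unit of `ℂ₂`. -/
theorem norm_one_sub_map_evS_reflQuotN_lt (β : RelNormCoherentUnits (isUniformizer_unit_mul h2 u) E)
    (z₀ : (maxNilIdealC F).toIdeal) :
    ‖1 - θ ((evS (maxNilIdealC F) z₀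
      (PowerSeries.subst (thetaBar h2 u hσ₀ hε) (reflQuotN hq h2 u E hE hσ₀ β)) : CBall F) :
        CompletedAlgClosure F)‖ < 1 := by
  rw [evS_subst (maxNilIdealC F) z₀ (constantCoeff_thetaBar h2 u hσ₀ hε)]
  exact norm_one_sub_map_lt_one_of_two_dvd θ hθ1 (two_dvd_evS_sub_one
    (constantCoeff_reflQuotN hq h2 u E hE hσ₀ β) (two_dvd_coeff_succ_reflQuotN hq h2 u E hE hσ₀ β) _)

include hθ1 in
/-- ★ **(β)-KEY**: `½·plog θ(P_β(ϑ̄ z₀)) = ½·plog θ(Q̄_β(ϑ̄ z₀)) + c_β` — the normalisation costs exactly a constant.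
(`plog` is additive on principal units ONLY; both factors are principal by §B, `hθ1` alone.) -/
theorem half_plog_reflQuotN_eq (β : RelNormCoherentUnits (isUniformizer_unit_mul h2 u) E)
    (z₀ : (maxNilIdealC F).toIdeal) :
    (2 : ℂ_[2])⁻¹ * PadicExp.plog (θ ((evS (maxNilIdealC F) z₀
        (PowerSeries.subst (thetaBar h2 u hσ₀ hε) (reflQuotN hq h2 u E hE hσ₀ β)) : CBall F) :
          CompletedAlgClosure F)) =
      (2 : ℂ_[2])⁻¹ * PadicExp.plog (θ ((evS (maxNilIdealC F) z₀
        (PowerSeries.subst (thetaBar h2 u hσ₀ hε) (reflQuotC hq h2 u E hE hσ₀ β)) : CBall F) :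
          CompletedAlgClosure F)) + gaugeConst hq h2 u E hE hσ₀ θ β := by
  have hq' := norm_one_sub_map_evS_reflQuotN_lt hq h2 u E hE hσ₀ hε θ hθ1 β z₀
  have hr := norm_one_sub_map_gaugeUnit_lt hq h2 u E hE hσ₀ θ hθ1 β
  have hinv : θ (((↑(gaugeUnit hq h2 u E hE hσ₀ β)⁻¹ : CBall F)) : CompletedAlgClosure F) *
      θ ((gaugeUnit hq h2 u E hE hσ₀ β : CBall F) : CompletedAlgClosure F) = 1 := by
    rw [← map_mul, ← Subring.coe_mul, Units.inv_mul, Subring.coe_one, map_one]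
  have hmul : θ ((evS (maxNilIdealC F) z₀
        (PowerSeries.subst (thetaBar h2 u hσ₀ hε) (reflQuotN hq h2 u E hE hσ₀ β)) : CBall F) :
          CompletedAlgClosure F) *
      θ ((gaugeUnit hq h2 u E hE hσ₀ β : CBall F) : CompletedAlgClosure F) =
      θ ((evS (maxNilIdealC F) z₀
        (PowerSeries.subst (thetaBar h2 u hσ₀ hε) (reflQuotC hq h2 u E hE hσ₀ β)) : CBall F) :
          CompletedAlgClosure F) := by
    rw [evS_subst_thetaBar_reflQuotN, Subring.coe_mul, map_mul, mul_right_comm, hinv, one_mul]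
  rw [ReadTwoCutK3G40.plog_eq_sub_of_mul_eq hq' hr hmul, gaugeConst]
  ring

variable (j : unitBall E →+* UnrCoeff F) (hjC : (algebraMap (UnrCoeff F) (CBall F)).comp j = unitBallToCBall E)

include hjC in
/-- ★ **IDENTIFICATION WITH THE WITNESS OF RECORD**: `θ̄(Q̄_β ∘ ϑ̄) = transport (reflQuot β) = Θ(j(Q_β) ∘ ϑ)`
(k3-g39's `V_β`-carrier; tree `map_subst_compSeriesC_map_eq`, the only place `j`/`hjC` enter). -/
theorem map_subst_thetaBar_reflQuotC_eq_transport (β : RelNormCoherentUnits (isUniformizer_unit_mul h2 u) E) :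
    (PowerSeries.subst (thetaBar h2 u hσ₀ hε) (reflQuotC hq h2 u E hE hσ₀ β)).map (θ.comp (CBall F).subtype) =
      ReflectionPrimitiveK3G39.transport h2 u E hσ₀ j hε θ
        (ReflectionPrimitiveK3G39.reflQuot (isUniformizer_unit_mul h2 u) E hq hE hσ₀ β : PowerSeries (unitBall E)) :=
  (map_subst_compSeriesC_map_eq h2 u E hσ₀ j hε θ hjC _).symm

include hθc hjC in
/-- ★ the VALUE of the transported quotient at `z₀`, as the reading evaluates it, is `θ(Q̄_β(ϑ̄ z₀))`. -/
theorem transport_reflQuot_value (β : RelNormCoherentUnits (isUniformizer_unit_mul h2 u) E)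
    (z₀ : (maxNilIdealC F).toIdeal) :
    ∑' m : ℕ, PowerSeries.coeff m (ReflectionPrimitiveK3G39.transport h2 u E hσ₀ j hε θ
        (ReflectionPrimitiveK3G39.reflQuot (isUniformizer_unit_mul h2 u) E hq hE hσ₀ β : PowerSeries (unitBall E))) *
        (θ ((z₀ : CBall F) : CompletedAlgClosure F)) ^ m =
      θ ((evS (maxNilIdealC F) z₀
        (PowerSeries.subst (thetaBar h2 u hσ₀ hε) (reflQuotC hq h2 u E hE hσ₀ β)) : CBall F) :
          CompletedAlgClosure F) := by
  rw [← map_subst_thetaBar_reflQuotC_eq_transport hq h2 u E hE hσ₀ hε θ j hjC]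
  exact (hasSum_map_coeff_mul_pow θ hθc _ z₀).tsum_eq

include hθc hθ1 hjC in
/-- ★★ **(α) + (β)-KEY COMBINED, in the shape the reading consumes**: the reading witness of `P_β` along `ϑ̄`
evaluates at `z₀` to `½·plog (V_β-value at z₀) + c_β`, where the `V_β`-value is the evaluated TRANSPORT of record
and `c_β` does not depend on `z₀` (so it lands in `read₂_of_refl_cut`'s `c`). -/
theorem inst₂_core_alpha_beta (β : RelNormCoherentUnits (isUniformizer_unit_mul h2 u) E)
    (z₀ : (maxNilIdealC F).toIdeal) :
    ∃ L y : PowerSeries (CBall F), PowerSeries.constantCoeff y = 0 ∧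
      reflQuotN hq h2 u E hE hσ₀ β = 1 + PowerSeries.C (2 : CBall F) * y ∧
      θ ((PowerSeries.coeff 0 L : CBall F) : CompletedAlgClosure F) = 0 ∧
      ∑' m : ℕ, PowerSeries.coeff m (PowerSeries.map (θ.comp (CBall F).subtype)
          (PowerSeries.subst (thetaBar h2 u hσ₀ hε) (PowerSeries.subst y L))) *
          (θ ((z₀ : CBall F) : CompletedAlgClosure F)) ^ m =
        (2 : ℂ_[2])⁻¹ * PadicExp.plog
          (∑' m : ℕ, PowerSeries.coeff m (ReflectionPrimitiveK3G39.transport h2 u E hσ₀ j hε θ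
            (ReflectionPrimitiveK3G39.reflQuot (isUniformizer_unit_mul h2 u) E hq hE hσ₀ β :
              PowerSeries (unitBall E))) * (θ ((z₀ : CBall F) : CompletedAlgClosure F)) ^ m) +
          gaugeConst hq h2 u E hE hσ₀ θ β := by
  obtain ⟨L, y, hy0, hPy, hL0, hval⟩ := inst₂_core_alpha hq h2 u E hE hσ₀ hε θ hθc hθ1 β z₀
  refine ⟨L, y, hy0, hPy, hL0, ?_⟩
  rw [hval, half_plog_reflQuotN_eq hq h2 u E hE hσ₀ hε θ hθ1 β z₀,
    transport_reflQuot_value hq h2 u E hE hσ₀ hε θ hθc j hjC β z₀]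

/-! ### §F  The LOG-BRANCH remark for (β)/(δ) (new observation) and the quotient identity it needs. -/

/-- `Q_β · τ_E g_β = g_β` (units of `𝒪_E⟦X⟧`, k3-g39's definition unfolded). -/
theorem reflQuot_mul_reflE (β : RelNormCoherentUnits (isUniformizer_unit_mul h2 u) E) :
    (ReflectionPrimitiveK3G39.reflQuot (isUniformizer_unit_mul h2 u) E hq hE hσ₀ β : PowerSeries (unitBall E)) *
        reflE (isUniformizer_unit_mul h2 u) E
          (ReflectionPrimitiveK3G39.gUnit (isUniformizer_unit_mul h2 u) E hq hE hσ₀ β : PowerSeries (unitBall E)) =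
      (ReflectionPrimitiveK3G39.gUnit (isUniformizer_unit_mul h2 u) E hq hE hσ₀ β : PowerSeries (unitBall E)) := by
  have h := congrArg Units.val (inv_mul_cancel_right
    (ReflectionPrimitiveK3G39.gUnit (isUniformizer_unit_mul h2 u) E hq hE hσ₀ β)
    (reflEUnit (isUniformizer_unit_mul h2 u) E
      (ReflectionPrimitiveK3G39.gUnit (isUniformizer_unit_mul h2 u) E hq hE hσ₀ β)))
  rw [Units.val_mul, coe_reflEUnit] at h
  exact h

/-- `τ_E` is `𝒪_E`-linear on constants: `τ_E (C a · G) = C a · τ_E G`. -/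
theorem reflE_C_mul (a : unitBall E) (G : PowerSeries (unitBall E)) :
    reflE (isUniformizer_unit_mul h2 u) E (PowerSeries.C a * G) =
      PowerSeries.C a * reflE (isUniformizer_unit_mul h2 u) E G := by
  rw [map_mul, reflE_C]

/-- ★ **LOG-BRANCH REMARK (β′)**: the reflection quotient is GAUGE-INVARIANT under `g ↦ C a · g` — so in the REFL
presentation `plog Q̄_β(w) = Lg a − Lg (a+s)` one may (and must) take `Lg` on the PRINCIPAL normalisation
`g_β/g_β(0)` (`g_β(w_a)` itself is a unit of `𝒪_ℂ` but NOT a principal unit when `[k_E : 𝔽₂] > 1`, and `plog` of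
record is the principal branch). -/
theorem quot_mul_reflE_rescale {Q G : PowerSeries (unitBall E)}
    (h : Q * reflE (isUniformizer_unit_mul h2 u) E G = G) (a : unitBall E) :
    Q * reflE (isUniformizer_unit_mul h2 u) E (PowerSeries.C a * G) = PowerSeries.C a * G := by
  rw [reflE_C_mul h2 u, mul_left_comm, h]

end Witness

end Summit.BirchSwinnertonDyer.BirchSwinnertonDyer.Cruxes.SplitBadTwoLowerHalfOfFacts.InstCoreK1G41
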